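import Literature.Probability.Distributions.EfronMonotonicity
import Literature.Probability.LatticeModels.FKGEqualityChains
import HarnessLib

/-!
# Profile grid, preliminaries: monotone densities, coordinatewise push-forwards, conditional independence on layers

Prover prim-ineq-prove-3 gen 44 (`--supports stmt-CriticalPhenomena-4575`; programme memo
`run/shared/lean/prim/prim-ineq-prove-3/PROOF-G43-DISJOINT-OR.md`).  First of four files proving the PROFILE-GRID form of the
one-step inequality `(2′)` for an OR of thresholds of disjoint blocks (`…ProfileGrid.grid_osN_nonneg`), from which
`…SahiOneStepDisjointOr` deduces `(2′)` and Kahn C5 / Sahi `C₃` on the cube.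

Setting: a finite index type `κ` of blocks, configurations `v : κ → Fin (N+1)` of block counts, product weights
`piWeight N φ v = Π_j φ_j(v_j)` (from `Literature.Probability.Distributions.EfronMonotonicity`).  Contents:
* `cross_le_of_le`, `exists_monotone_density` — a nonnegative numerator `u ≤ Φ` satisfying the ONE-COORDINATE cross inequalities
  `u(v with v_j := x)·φ_j(x') ≤ u(v with v_j := x')·φ_j(x)` is `a·Φ` for a non-decreasing `a ≥ 0` on the whole grid (this is how an
  arbitrary increasing event of the cube enters: `u(v) = μ(A ∩ {profile = v})`);
* `sum_prod_mul_comp_eq` — push-forward of a product weight under a coordinatewise map is the product of the per-coordinate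
  push-forwards;
* `laySum_mul_laySum_of_split` — on every layer of a block sum over `K`, a `K`-measurable and a `Kᶜ`-measurable function are
  uncorrelated (exchange involution `mixEquiv` of `Literature.Probability.LatticeModels.FKGEqualityChains`);
* `isLogSupermodular_prod` — product weights on a product of chains are log-modular (hypothesis of Mathlib's four-functions FKG).
No new definitions, no sorries.
-/

namespace Summit.CriticalPhenomena.PercolationContinuityZ3.Theorems

namespace SahiOneStep

namespace ProfileGrid

open Finset Function
open Literature.Probability.Distributions (IsLogConcaveSeq piWeight blockSum laySum laySum_def)
open Literature.Probability.LatticeModels.FKGEqualityChains (mix IsLogSupermodular)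

variable {κ : Type*} [Fintype κ] [DecidableEq κ] {N : ℕ}

/-! ## Product weights: positivity, one-coordinate factorisation -/

omit [DecidableEq κ] in
/-- The product weight of nonnegative weights is nonnegative. [folklore] -/
theorem piWeight_nonneg {φ : κ → ℕ → ℝ} (hφ : ∀ j n, 0 ≤ φ j n) (v : κ → Fin (N + 1)) : 0 ≤ piWeight N φ v :=
  prod_nonneg fun j _ => hφ j _

/-- `Π_j φ_j(v_j) = φ_i(v_i) · Π_{j ≠ i} φ_j(v_j)`. [folklore] -/
theorem piWeight_eq_mul_erase (φ : κ → ℕ → ℝ) (i : κ) (v : κ → Fin (N + 1)) :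
    piWeight N φ v = φ i (v i) * ∏ j ∈ univ.erase i, φ j (v j) := by
  unfold piWeight; rw [← mul_prod_erase univ (fun j => φ j (v j)) (mem_univ i)]

/-- `Π_j φ_j((v with v_i := c)_j) = φ_i(c) · Π_{j ≠ i} φ_j(v_j)`. [folklore] -/
theorem piWeight_update (φ : κ → ℕ → ℝ) (i : κ) (v : κ → Fin (N + 1)) (c : Fin (N + 1)) :
    piWeight N φ (update v i c) = φ i c * ∏ j ∈ univ.erase i, φ j (v j) := by
  rw [piWeight_eq_mul_erase φ i, update_self]
  congr 1
  exact prod_congr rfl fun j hj => by rw [update_of_ne (ne_of_mem_erase hj)]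

omit [DecidableEq κ] in
/-- A positive product weight has all its factors nonzero. [folklore] -/
theorem factor_ne_zero_of_piWeight_pos {φ : κ → ℕ → ℝ} {v : κ → Fin (N + 1)} (h : 0 < piWeight N φ v) (j : κ) :
    φ j (v j) ≠ 0 := fun h0 => by
  have : piWeight N φ v = 0 := prod_eq_zero (mem_univ j) h0
  rw [this] at h; exact lt_irrefl 0 h

/-! ## A monotone density for a numerator satisfying the one-coordinate cross inequalities -/

/-- **Cross inequality for comparable configurations.**  If `u` satisfies the one-coordinate cross inequalities
`u(v with v_j:=x)·φ_j(x') ≤ u(v with v_j:=x')·φ_j(x)` (`x ≤ x'`) w.r.t. a nonnegative product weight `Φ = Π φ_j`, then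
`u(v)·Φ(v') ≤ u(v')·Φ(v)` for all `v ≤ v'` with `Φ(v), Φ(v') > 0`. [this work] -/
theorem cross_le_of_le {φ : κ → ℕ → ℝ} (hφ : ∀ j n, 0 ≤ φ j n) (u : (κ → Fin (N + 1)) → ℝ)
    (hmono : ∀ v j (x x' : Fin (N + 1)), x ≤ x' → u (update v j x) * φ j x' ≤ u (update v j x') * φ j x)
    {v v' : κ → Fin (N + 1)} (hvv' : v ≤ v') (hv : 0 < piWeight N φ v) (hv' : 0 < piWeight N φ v') :
    u v * piWeight N φ v' ≤ u v' * piWeight N φ v := by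
  -- induction on a set `s` outside of which `v` and `v'` agree
  suffices H : ∀ (s : Finset κ) (v v' : κ → Fin (N + 1)), v ≤ v' → (∀ j, j ∉ s → v j = v' j) →
      0 < piWeight N φ v → 0 < piWeight N φ v' → u v * piWeight N φ v' ≤ u v' * piWeight N φ v from
    H univ v v' hvv' (fun j hj => absurd (mem_univ j) hj) hv hv'
  intro s
  induction s using Finset.induction_on with
  | empty =>
    intro v v' _ hagree _ _
    have : v = v' := funext fun j => hagree j (by simp)
    rw [this]
  | insert i s hi ih =>
    intro v v' hle hagree hv hv'
    -- intermediate configuration `v'' = v with v_i := v'_i`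
    set v'' := update v i (v' i) with hv''
    have h1 : v ≤ v'' := fun j => by
      by_cases hj : j = i
      · subst hj; rw [hv'', update_self]; exact hle j
      · rw [hv'', update_of_ne hj]
    have h2 : v'' ≤ v' := fun j => by
      by_cases hj : j = i
      · subst hj; rw [hv'', update_self]
      · rw [hv'', update_of_ne hj]; exact hle j
    have hagree' : ∀ j, j ∉ s → v'' j = v' j := fun j hj => by
      by_cases hji : j = i
      · subst hji; rw [hv'', update_self]
      · rw [hv'', update_of_ne hji]; exact hagree j (by rw [mem_insert]; tauto)
    -- `Φ(v'') > 0`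
    set P : ℝ := ∏ j ∈ univ.erase i, φ j (v j) with hP
    have hP0 : 0 ≤ P := prod_nonneg fun j _ => hφ j _
    have hΦv : piWeight N φ v = φ i (v i) * P := piWeight_eq_mul_erase φ i v
    have hΦv'' : piWeight N φ v'' = φ i (v' i) * P := piWeight_update φ i v (v' i)
    have hpos'' : 0 < piWeight N φ v'' := by
      rw [hΦv'']
      refine lt_of_le_of_ne (mul_nonneg (hφ i _) hP0) (Ne.symm (mul_ne_zero (factor_ne_zero_of_piWeight_pos hv' i) ?_))
      intro hP'
      rw [hΦv, hP', mul_zero] at hv; exact lt_irrefl 0 hv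
    -- the two comparisons
    have c1 : u v * piWeight N φ v'' ≤ u v'' * piWeight N φ v := by
      have := hmono v i (v i) (v' i) (hle i)
      rw [update_eq_self] at this
      rw [hΦv'', hΦv]
      have := mul_le_mul_of_nonneg_right this hP0
      nlinarith [this]
    have c2 : u v'' * piWeight N φ v' ≤ u v' * piWeight N φ v'' := ih v'' v' h2 hagree' hpos'' hv'
    -- chain through `Φ(v'') > 0`
    have e1 := mul_le_mul_of_nonneg_right c1 hv'.le
    have e2 := mul_le_mul_of_nonneg_right c2 hv.le
    have : piWeight N φ v'' * (u v * piWeight N φ v') ≤ piWeight N φ v'' * (u v' * piWeight N φ v) := by nlinarith [e1, e2]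
    exact le_of_mul_le_mul_left this hpos''

/-- **Monotone density.**  A nonnegative numerator `u ≤ Φ` satisfying the one-coordinate cross inequalities w.r.t. the product
weight `Φ` is `a · Φ` for a NON-DECREASING nonnegative `a` on the whole grid (on the support `a = u/Φ`; off the support `a` is the
largest admissible value below). [this work] -/
theorem exists_monotone_density {φ : κ → ℕ → ℝ} (hφ : ∀ j n, 0 ≤ φ j n) (u : (κ → Fin (N + 1)) → ℝ) (hu0 : ∀ v, 0 ≤ u v)
    (huΦ : ∀ v, u v ≤ piWeight N φ v)
    (hmono : ∀ v j (x x' : Fin (N + 1)), x ≤ x' → u (update v j x) * φ j x' ≤ u (update v j x') * φ j x) :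
    ∃ a : (κ → Fin (N + 1)) → ℝ, Monotone a ∧ (∀ v, 0 ≤ a v) ∧ ∀ v, u v = a v * piWeight N φ v := by
  classical
  -- the admissible lower configurations of `v`
  set T : (κ → Fin (N + 1)) → Finset (κ → Fin (N + 1)) := fun v => univ.filter fun v' => v' ≤ v ∧ 0 < piWeight N φ v' with hT
  set a : (κ → Fin (N + 1)) → ℝ := fun v =>
    if h : (T v).Nonempty then (T v).sup' h (fun v' => u v' / piWeight N φ v') else 0 with ha
  have hT_mono : ∀ {v₁ v₂}, v₁ ≤ v₂ → T v₁ ⊆ T v₂ := fun h v' hv' => by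
    simp only [hT, mem_filter, mem_univ, true_and] at hv' ⊢; exact ⟨hv'.1.trans h, hv'.2⟩
  have hratio0 : ∀ v', 0 ≤ u v' / piWeight N φ v' := fun v' => div_nonneg (hu0 v') (piWeight_nonneg hφ v')
  have ha0 : ∀ v, 0 ≤ a v := fun v => by
    simp only [ha]
    split_ifs with h
    · obtain ⟨v', hv'⟩ := h
      exact (hratio0 v').trans (le_sup' (fun v' => u v' / piWeight N φ v') hv')
    · exact le_rfl
  refine ⟨a, fun v₁ v₂ h12 => ?_, ha0, fun v => ?_⟩
  · -- monotone
    simp only [ha]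
    by_cases h1 : (T v₁).Nonempty
    · have h2 : (T v₂).Nonempty := h1.mono (hT_mono h12)
      rw [dif_pos h1, dif_pos h2]
      exact sup'_le h1 _ fun v' hv' => le_sup' (fun v' => u v' / piWeight N φ v') (hT_mono h12 hv')
    · rw [dif_neg h1]
      have := ha0 v₂; simp only [ha] at this; exact this
  · -- `u = a Φ`
    rcases (piWeight_nonneg hφ v).lt_or_eq with hpos | hzero
    · have hvT : v ∈ T v := by simp only [hT, mem_filter, mem_univ, true_and]; exact ⟨le_rfl, hpos⟩
      have hne : (T v).Nonempty := ⟨v, hvT⟩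
      have hav : a v = u v / piWeight N φ v := by
        simp only [ha]; rw [dif_pos hne]
        refine le_antisymm (sup'_le hne _ fun v' hv' => ?_) (le_sup' (fun v' => u v' / piWeight N φ v') hvT)
        simp only [hT, mem_filter, mem_univ, true_and] at hv'
        rw [div_le_div_iff₀ hv'.2 hpos]
        exact cross_le_of_le hφ u hmono hv'.1 hv'.2 hpos
      rw [hav, div_mul_cancel₀ _ hpos.ne']
    · have hu : u v = 0 := le_antisymm (by rw [hzero]; exact huΦ v) (hu0 v)
      rw [hu, ← hzero, mul_zero]

/-! ## Push-forward of a product weight under a coordinatewise map -/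

/-- **Coordinatewise push-forward.**  Summing a product weight against `g` of a coordinatewise image is summing the product of the
per-coordinate push-forwards against `g`. [folklore] -/
theorem sum_prod_mul_comp_eq {A : Type*} [Fintype A] [DecidableEq A] (wt : κ → A → ℝ) (w : κ → A → Fin (N + 1))
    (g : (κ → Fin (N + 1)) → ℝ) :
    ∑ c : κ → A, (∏ j, wt j (c j)) * g (fun j => w j (c j)) =
      ∑ v : κ → Fin (N + 1), (∏ j, ∑ a : A, if w j a = v j then wt j a else 0) * g v := by
  have expand : ∀ v : κ → Fin (N + 1), (∏ j, ∑ a : A, if w j a = v j then wt j a else 0) =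
      ∑ c : κ → A, if (fun j => w j (c j)) = v then ∏ j, wt j (c j) else 0 := by
    intro v
    rw [Fintype.prod_sum]
    refine Fintype.sum_congr _ _ fun c => ?_
    rw [Fintype.prod_ite_zero]
    by_cases h : (fun j => w j (c j)) = v
    · rw [if_pos h, if_pos (fun j => congr_fun h j)]
    · rw [if_neg h, if_neg (fun h' => h (funext h'))]
  simp_rw [expand, sum_mul]
  rw [sum_comm]
  refine Fintype.sum_congr _ _ fun c => ?_
  rw [Fintype.sum_eq_single (fun j => w j (c j)) (fun v hv => by rw [if_neg (Ne.symm hv), zero_mul])]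
  rw [if_pos rfl]

/-! ## Conditional independence of `K`-measurable and `Kᶜ`-measurable functions given the block sum over `K` -/

omit [Fintype κ] [DecidableEq κ] in
/-- The block sum over `K` of `mix K x β` is that of `x`. [folklore] -/
theorem blockSum_mix (K : Finset κ) (x β : κ → Fin (N + 1)) : blockSum K (mix (↑K : Set κ) x β) = blockSum K x := by
  unfold blockSum
  exact sum_congr rfl fun j hj => by simp only [mix, mem_coe.2 hj, if_true]

omit [DecidableEq κ] in
/-- A product weight splits along any coordinate set (exchange form). [folklore] -/
theorem piWeight_mix_mul (K : Finset κ) (φ : κ → ℕ → ℝ) (x β : κ → Fin (N + 1)) :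
    piWeight N φ (mix (↑K : Set κ) x β) * piWeight N φ (mix (↑K : Set κ) β x) = piWeight N φ x * piWeight N φ β := by
  unfold piWeight
  rw [← prod_mul_distrib, ← prod_mul_distrib]
  refine prod_congr rfl fun j _ => ?_
  by_cases hj : j ∈ (↑K : Set κ) <;> simp only [mix, hj, if_true, if_false, mul_comm]

/-- **Factorisation of layer sums.**  If `ψ` depends only on the coordinates outside `K` and `k` only on those inside `K`, then on
every layer of the `K`-block sum `L(ψ k)·L(1) = L(ψ)·L(k)` (conditional independence). [this work] -/
theorem laySum_mul_laySum_of_split (φ : κ → ℕ → ℝ) (K : Finset κ) (ψ k : (κ → Fin (N + 1)) → ℝ)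
    (hψ : ∀ x β, ψ (mix (↑K : Set κ) x β) = ψ β) (hk : ∀ x β, k (mix (↑K : Set κ) x β) = k x) (s : ℕ) :
    laySum N φ K (fun y => ψ y * k y) s * laySum N φ K (fun _ => 1) s = laySum N φ K ψ s * laySum N φ K k s := by
  classical
  -- both sides as double sums; reindex by the involution `(x, β) ↦ (mix x β, mix β x)`
  set Tm : (κ → Fin (N + 1)) × (κ → Fin (N + 1)) → ℝ := fun p =>
    (if blockSum K p.1 = s then piWeight N φ p.1 * ψ p.1 else 0) * (if blockSum K p.2 = s then piWeight N φ p.2 * k p.2 else 0)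
    with hTm
  have rhs : laySum N φ K ψ s * laySum N φ K k s = ∑ p : (κ → Fin (N + 1)) × (κ → Fin (N + 1)), Tm p := by
    rw [laySum_def, laySum_def, sum_mul_sum, ← Fintype.sum_prod_type']
  have lhs : laySum N φ K (fun y => ψ y * k y) s * laySum N φ K (fun _ => 1) s =
      ∑ p : (κ → Fin (N + 1)) × (κ → Fin (N + 1)),
        Tm (Literature.Probability.LatticeModels.FKGEqualityChains.mixEquiv (↑K : Set κ) p) := by
    rw [laySum_def, laySum_def, mul_comm, sum_mul_sum, ← Fintype.sum_prod_type']
    refine Fintype.sum_congr _ _ fun p => ?_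
    simp only [hTm, Literature.Probability.LatticeModels.FKGEqualityChains.mixEquiv, Equiv.coe_fn_mk, blockSum_mix]
    rw [hψ, hk]
    by_cases h1 : blockSum K p.1 = s <;> by_cases h2 : blockSum K p.2 = s <;>
      simp only [h1, h2, if_true, if_false, mul_zero, zero_mul, mul_one]
    have := piWeight_mix_mul K φ p.1 p.2
    calc piWeight N φ p.1 * (piWeight N φ p.2 * (ψ p.2 * k p.2))
        = (piWeight N φ p.1 * piWeight N φ p.2) * (ψ p.2 * k p.2) := by ring
      _ = (piWeight N φ (mix (↑K : Set κ) p.1 p.2) * piWeight N φ (mix (↑K : Set κ) p.2 p.1)) * (ψ p.2 * k p.2) := by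
          rw [this]
      _ = piWeight N φ (mix (↑K : Set κ) p.1 p.2) * ψ p.2 * (piWeight N φ (mix (↑K : Set κ) p.2 p.1) * k p.2) := by ring
  rw [lhs, rhs]
  exact Equiv.sum_comp (Literature.Probability.LatticeModels.FKGEqualityChains.mixEquiv (↑K : Set κ)) Tm

/-! ## Product weights on a product of chains are log-(super)modular -/

omit [DecidableEq κ] in
/-- A product weight on `κ → Fin (M+1)` is log-modular, hence log-supermodular (Mathlib's `fkg` hypothesis). [folklore] -/
theorem isLogSupermodular_prod {M : ℕ} (ρ : κ → Fin (M + 1) → ℝ) :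
    IsLogSupermodular (fun θ : κ → Fin (M + 1) => ∏ j, ρ j (θ j)) := by
  intro a b
  show (∏ j, ρ j (a j)) * (∏ j, ρ j (b j)) ≤ (∏ j, ρ j ((a ⊓ b) j)) * ∏ j, ρ j ((a ⊔ b) j)
  rw [← prod_mul_distrib, ← prod_mul_distrib]
  refine le_of_eq (prod_congr rfl fun j _ => ?_)
  simp only [Pi.inf_apply, Pi.sup_apply]
  rcases le_total (a j) (b j) with h | h
  · rw [inf_eq_left.2 h, sup_eq_right.2 h]
  · rw [inf_eq_right.2 h, sup_eq_left.2 h, mul_comm]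

end ProfileGrid

end SahiOneStep

end Summit.CriticalPhenomena.PercolationContinuityZ3.Theorems
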